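import Mathlib.Analysis.Fourier.FourierTransform
import Mathlib.Analysis.Calculus.ParametricIntegral
import Mathlib.Analysis.Complex.CauchyIntegral
import Mathlib.Analysis.MeanInequalities
import Mathlib.Analysis.SpecialFunctions.Pow.Real
import Mathlib.Analysis.SpecialFunctions.ImproperIntegrals
import Mathlib.MeasureTheory.Measure.WithDensity
import Mathlib.MeasureTheory.Integral.Bochner.ContinuousLinearMap
import Mathlib.MeasureTheory.Function.L1Space.HasFiniteIntegral
import Mathlib.MeasureTheory.Measure.Lebesgue.Integral
import Mathlib.MeasureTheory.Function.Floor
import Mathlib.MeasureTheory.Measure.Prod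
import Literature.Analysis.Complex.StripResidueFormula
import Literature.Analysis.Fourier.FractalUncertaintyFourierTools
import Literature.Analysis.Fourier.FractalUncertaintyHarmonicInterpolation
import Literature.Analysis.Fourier.FractalUncertaintyPrinciple
import HarnessLib

/-!
# Bourgain–Dyatlov 2018, §3.2: Lemma 3.2 from the harmonic-measure facts of §2.4

Analysis/Fourier proof file; companion to `FractalUncertaintyPrinciple` (the named fact
`Literature.Analysis.Fourier.bourgainDyatlov2018_thm4`, J. Bourgain–S. Dyatlov, *Spectral gaps
without the pressure condition*, Ann. of Math. 187 (2018), Theorem 4) and sequel to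
`FractalUncertaintyHarmonicInterpolation` (the per-point interpolation (2.10) ⟹ (3.15)).
In the tree, Theorem 4 is reduced (`FractalUncertaintyReduction.lean`) to the unique-continuation
proposition of BD18 §3.3, whose two inputs are Lemma 3.1 (`FractalUncertaintyAdaptedWeight.lean`)
and **Lemma 3.2** ("a bound on functions with compact Fourier support"). BD18 proves Lemma 3.2 in
§3.2 from four facts about the harmonic measure `μ_t` of the slit strip
`Σ = {|Im z| < r} ∖ I₀` (§2.4: Lemma 2.12 = the sub-mean-value inequality (2.10); Lemma 2.13 =
the `L^p(I_±)`, `p < 2`, bound (2.11) on the density of `μ_t` on the slit; Lemma 2.14 = the bound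
`(2/r)e^{-d(x,I₀)}` (2.12) on the density on the lines `Im z = ±r`; Lemma 2.15 = the lower bound
`μ_t(I_±) ≥ (|I₀|/8)e^{-2/r}` (2.13)). Harmonic measure (Perron solutions, conformal invariance)
is not available in Mathlib, so this file proves the deduction **§2.4 ⟹ Lemma 3.2** sorry-free,
with the §2.4 facts entering as ONE explicit hypothesis `h24` of the final theorem (no new named
fact is introduced). `h24` renders Lemmas 2.12–2.15 through densities: for `I₀ = [a, a+ℓ]`,
`0 < ℓ ≤ 1`, `0 < r < 1` and real `t` with `ℓ/10 ≤ d(t,I₀) ≤ 1`, there are densities `ρ₀ ≥ 0`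
on `I₀` (the two copies `I_±` of the slit together; `F` below is continuous across the slit) and
`ρ₁, ρ₂ ≥ 0` on the lines `Im z = +r, -r`, of total mass `1` (`μ_t` is a probability measure),
with `∫ ρ₀ ≥ (ℓ/4)e^{-2/r}` (Lemma 2.15 for `I_+` and `I_-`), `ρ₁, ρ₂ ≤ (2/r)e^{-d(x,I₀)}`
(Lemma 2.14), the `p = 4/3` case of Lemma 2.13 in the dual form in which (3.16) uses it
(`(∫ u ρ₀)⁴ ≤ C_ℓ ∫_{I₀} u⁴` for bounded measurable `u ≥ 0`, i.e. Hölder with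
`C_ℓ = ‖ρ₀‖⁴_{L^{4/3}}`), and (2.10) for the functions `log(|F|²+ε)`, `ε > 0`, `F` entire and
bounded on `{|Im z| ≤ r}` — which follows from Lemma 2.12 as printed, applied to the bounded
holomorphic functions `G = αF + β√ε`, `|α|²+|β|² = 1`: `2 log|G| ≤ log(|F|²+ε)` everywhere, with
equality at `t` for a suitable `(α, β)`; the regularisation only avoids Lean's `log 0 = 0`.

Contents (the printed proof of Lemma 3.2, step by step):
* `differentiable_fourierLaplaceInv`, `fourierLaplaceInv_line`, `fourierLaplaceInv_ofReal`,
  `norm_fourierLaplaceInv_le`, `integral_norm_sq_fourierLaplaceInv_line` — "since `f̂` is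
  compactly supported, `f` has a holomorphic continuation `F(z) = ∫ e^{2πizξ} f̂(ξ)dξ`", bounded on
  the strip, with the line identity (3.14) `∫ |F(x+iy)|² dx = ∫ e^{-4πyξ}|f̂(ξ)|² dξ ≤ ‖e^{2πr|ξ|}f̂‖²`;
* `interpolation_of_log_subMeanValue_density` — (2.10) ⟹ (3.15) for measures with densities;
* `pointwise_bound_algebra` — (3.15) & (3.16) & (3.17) ⟹ `|f(t)|² ≤ 10(max C 2/r) A^κ(A+B)^{1-κ}`;
* `integral_rpow_mul_rpow_le` — the Hölder step `∫ A^κ Q^{1-κ} ≤ (∫A)^κ(∫Q)^{1-κ}` (by AM–GM);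
* `lintegral_lintegral_kernel_le`, `volume_setOf_mem_cell_floor_le`,
  `lintegral_exp_one_sub_abs_le` — the bounded-overlap sums of the printed proof
  (`Σ_I ‖f‖²_{L²(I'')} = ‖f‖²_{L²(U'')}`, `Σ_I e^{-d(x,I)} ≤ C`), done by Tonelli with the cell
  index `j = ⌊t⌋` (`{t : x ∈ I''_{⌊t⌋}}` has measure `≤ 2`, `∫ e^{1-|x-t|} dt = 2e`);
* `lemma32_of_harmonicMeasure` — **Lemma 3.2** for the tiling `𝓘 = {[j, j+1] : j ∈ ℤ}` with
  subintervals `I''_j = [s_j - c₀/2, s_j + c₀/2] ⊆ [j, j+1]` (the case used in §3.3), for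
  `f = 𝓕⁻ g`, `g ∈ L¹ ∩ L²` vanishing off `[-R, R]`:
  `‖f‖²_{L²} ≤ (C/r) ‖f‖_{L²(U'')}^{2κ} (∫ e^{4πr|ξ|}|g(ξ)|² dξ)^{1-κ}` for `0 < r < 1`,
  `0 < κ ≤ e^{-C/r}`, `C = C(c₀)`; here `Σ_{I} ‖f‖²_{L²(I)} = ‖f‖²_{L²}` because the tiles
  `[j, j+1]` overlap in endpoints only.

Deliberately NOT here: the harmonic measure of `Σ` itself and Lemmas 2.12–2.15 (hypothesis
`h24`); the general tiling `𝓘` of Lemma 3.2 (only the unit tiling is used in §3.3).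
-/

namespace Literature.Analysis.Fourier

open _root_.MeasureTheory Set Filter _root_.Complex
open scoped FourierTransform ENNReal NNReal Topology Real

/-- **The holomorphic extension of a function with compact Fourier support** (BD18, proof of
Lemma 3.2: "since `f̂` is compactly supported, `f` has a holomorphic continuation
`F(z) = ∫ e^{2πizξ} f̂(ξ) dξ`"): for `g ∈ L¹` vanishing off `[-R, R]`, `z ↦ ∫ e^{2πizξ} g(ξ) dξ`
is entire. [cite: BourgainDyatlov2018, Lemma 3.2 (proof)] -/
theorem differentiable_fourierLaplaceInv {g : ℝ → ℂ} (hg : Integrable g) {R : ℝ} (hR : 0 ≤ R)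
    (hsupp : ∀ ξ, R < |ξ| → g ξ = 0) :
    Differentiable ℂ fun z : ℂ => ∫ ξ : ℝ, Complex.exp (2 * π * I * z * ξ) * g ξ := by
  intro z₀
  set F : ℂ → ℝ → ℂ := fun z ξ => Complex.exp (2 * π * I * z * ξ) * g ξ with hF
  set F' : ℂ → ℝ → ℂ := fun z ξ => (2 * π * I * ξ) * (Complex.exp (2 * π * I * z * ξ) * g ξ)
    with hF'
  set M : ℝ := Real.exp (2 * π * R * (‖z₀‖ + 1)) with hM
  set bound : ℝ → ℝ := fun ξ => 2 * π * R * M * ‖g ξ‖ with hbound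
  have hexp_norm : ∀ (z : ℂ) (ξ : ℝ), ‖Complex.exp (2 * π * I * z * ξ)‖ ≤
      Real.exp (2 * π * |ξ| * ‖z‖) := by
    intro z ξ
    rw [Complex.norm_exp, Real.exp_le_exp]
    have hre : (2 * π * I * z * ξ).re = -(2 * π * ξ * z.im) := by
      simp [Complex.mul_re, Complex.mul_im]; ring
    rw [hre]
    have h1 : -(ξ * z.im) ≤ |ξ| * ‖z‖ := by
      calc -(ξ * z.im) ≤ |ξ * z.im| := neg_le_abs _
        _ = |ξ| * |z.im| := abs_mul _ _
        _ ≤ |ξ| * ‖z‖ := mul_le_mul_of_nonneg_left (Complex.abs_im_le_norm z) (abs_nonneg _)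
    nlinarith [Real.pi_pos]
  have hmeas : ∀ z : ℂ, AEStronglyMeasurable (F z) volume := fun z =>
    ((Complex.continuous_exp.comp (by fun_prop)).aestronglyMeasurable).mul hg.aestronglyMeasurable
  have hint : ∀ z : ℂ, Integrable (F z) := by
    intro z
    refine Integrable.mono' (hg.norm.const_mul (Real.exp (2 * π * R * ‖z‖))) (hmeas z)
      (Eventually.of_forall fun ξ => ?_)
    simp only [hF, norm_mul]
    by_cases hξ : R < |ξ|
    · rw [hsupp ξ hξ, norm_zero, mul_zero]
      positivity
    · push Not at hξ
      have h1 : ‖Complex.exp (2 * π * I * z * ξ)‖ ≤ Real.exp (2 * π * R * ‖z‖) :=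
        (hexp_norm z ξ).trans (Real.exp_le_exp.2 (by
          have := mul_le_mul_of_nonneg_right hξ (norm_nonneg z)
          nlinarith [Real.pi_pos]))
      exact mul_le_mul_of_nonneg_right h1 (norm_nonneg _)
  have key := hasDerivAt_integral_of_dominated_loc_of_deriv_le (μ := volume) (x₀ := z₀)
    (F := F) (F' := F') (bound := bound) (Metric.ball_mem_nhds z₀ zero_lt_one)
    (Eventually.of_forall hmeas) (hint z₀) ?_ ?_ ?_ ?_
  · exact key.2.differentiableAt
  · simp only [hF']
    exact (by fun_prop : Continuous fun ξ : ℝ => (2 * π * I * ξ : ℂ)).aestronglyMeasurable.mul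
      (hmeas z₀)
  · refine Eventually.of_forall fun ξ z hz => ?_
    show ‖(2 * π * I * ξ) * (Complex.exp (2 * π * I * z * ξ) * g ξ)‖ ≤ 2 * π * R * M * ‖g ξ‖
    by_cases hξ : R < |ξ|
    · rw [hsupp ξ hξ]; simp
    · push Not at hξ
      rw [norm_mul, norm_mul (Complex.exp (2 * π * I * z * ξ)) (g ξ)]
      have hz' : ‖z‖ ≤ ‖z₀‖ + 1 := by
        have h1 : ‖z - z₀‖ < 1 := mem_ball_iff_norm.1 hz
        calc ‖z‖ = ‖z₀ + (z - z₀)‖ := by ring_nf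
          _ ≤ ‖z₀‖ + ‖z - z₀‖ := norm_add_le _ _
          _ ≤ ‖z₀‖ + 1 := by linarith
      have hcoef : ‖(2 * π * I * ξ : ℂ)‖ ≤ 2 * π * R := by
        rw [show (2 * π * I * ξ : ℂ) = ((2 * π * ξ : ℝ) : ℂ) * I by push_cast; ring, norm_mul,
          Complex.norm_I, mul_one, Complex.norm_real, Real.norm_eq_abs, abs_mul, abs_mul,
          abs_of_pos Real.pi_pos, abs_of_pos (by norm_num : (0:ℝ) < 2)]
        nlinarith [Real.pi_pos]
      have hexp : ‖Complex.exp (2 * π * I * z * ξ)‖ ≤ M := by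
        refine (hexp_norm z ξ).trans (Real.exp_le_exp.2 ?_)
        have : |ξ| * ‖z‖ ≤ R * (‖z₀‖ + 1) := mul_le_mul hξ hz' (norm_nonneg _) hR
        nlinarith [Real.pi_pos]
      calc ‖(2 * π * I * ξ : ℂ)‖ * (‖Complex.exp (2 * π * I * z * ξ)‖ * ‖g ξ‖)
          ≤ (2 * π * R) * (M * ‖g ξ‖) := by
            refine mul_le_mul hcoef (mul_le_mul_of_nonneg_right hexp (norm_nonneg _))
              (by positivity) (by positivity)
        _ = 2 * π * R * M * ‖g ξ‖ := by ring
  · exact hg.norm.const_mul _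
  · refine Eventually.of_forall fun ξ z _ => ?_
    show HasDerivAt (fun w : ℂ => Complex.exp (2 * π * I * w * ξ) * g ξ)
      ((2 * π * I * ξ) * (Complex.exp (2 * π * I * z * ξ) * g ξ)) z
    have h1 : HasDerivAt (fun w : ℂ => w * (2 * π * I * ξ)) (2 * π * I * ξ) z := by
      simpa using (hasDerivAt_id z).mul_const (2 * π * I * ξ)
    have h2 := (h1.cexp).mul_const (g ξ)
    have hfun : (fun w : ℂ => Complex.exp (2 * π * I * w * ξ) * g ξ) =
        fun w => Complex.exp (w * (2 * π * I * ξ)) * g ξ := by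
      funext w; congr 2; ring
    rw [hfun]
    refine h2.congr_deriv ?_
    rw [show z * (2 * ↑π * I * ↑ξ) = 2 * π * I * z * ξ by ring]
    ring

/-- The values of the holomorphic extension on horizontal lines are inverse Fourier integrals of
exponentially twisted functions: `F(x + iy) = 𝓕⁻(e^{-2πyξ} g)(x)` (BD18 (3.14)).
[cite: BourgainDyatlov2018, Lemma 3.2 (proof), (3.14)] -/
theorem fourierLaplaceInv_line (g : ℝ → ℂ) (x y : ℝ) :
    (∫ ξ : ℝ, Complex.exp (2 * π * I * (x + y * I) * ξ) * g ξ) =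
      (𝓕⁻ (fun ξ => (Real.exp (-(2 * π * y * ξ)) : ℂ) * g ξ) : ℝ → ℂ) x := by
  rw [Real.fourierInv_eq']
  congr 1; ext ξ
  simp only [RCLike.inner_apply, conj_trivial, smul_eq_mul]
  rw [← mul_assoc]
  congr 1
  rw [Complex.ofReal_exp, ← Complex.exp_add]
  congr 1
  push_cast
  ring_nf
  rw [Complex.I_sq]
  ring

/-- On real points the holomorphic extension is `f = 𝓕⁻ g`. [cite: BourgainDyatlov2018, Lemma 3.2 (proof)] -/
theorem fourierLaplaceInv_ofReal (g : ℝ → ℂ) (x : ℝ) :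
    (∫ ξ : ℝ, Complex.exp (2 * π * I * x * ξ) * g ξ) = (𝓕⁻ g : ℝ → ℂ) x := by
  have h := fourierLaplaceInv_line g x 0
  simp only [Complex.ofReal_zero, zero_mul, add_zero, mul_zero, neg_zero,
    Real.exp_zero, Complex.ofReal_one, one_mul] at h
  rw [h]

/-- **Bound on the strip**: `|F(x+iy)| ≤ ∫ e^{2π|y||ξ|} |g(ξ)| dξ ≤ ∫ e^{2πr|ξ|}|g|` for
`|y| ≤ r` ("The function `F(z)` is bounded on `{|Im z| ≤ r}`", BD18 proof of Lemma 3.2).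
[cite: BourgainDyatlov2018, Lemma 3.2 (proof)] -/
theorem norm_fourierLaplaceInv_le {g : ℝ → ℂ} (hg : Integrable g) {R : ℝ}
    (hsupp : ∀ ξ, R < |ξ| → g ξ = 0) {r : ℝ} (hr : 0 ≤ r) (x y : ℝ) (hy : |y| ≤ r) :
    ‖∫ ξ : ℝ, Complex.exp (2 * π * I * (x + y * I) * ξ) * g ξ‖ ≤
      Real.exp (2 * π * r * R) * ∫ ξ, ‖g ξ‖ := by
  calc ‖∫ ξ : ℝ, Complex.exp (2 * π * I * (x + y * I) * ξ) * g ξ‖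
      ≤ ∫ ξ : ℝ, ‖Complex.exp (2 * π * I * (x + y * I) * ξ) * g ξ‖ := norm_integral_le_integral_norm _
    _ ≤ ∫ ξ : ℝ, Real.exp (2 * π * r * R) * ‖g ξ‖ := by
        refine integral_mono_of_nonneg (Eventually.of_forall fun _ => norm_nonneg _)
          (hg.norm.const_mul _) (Eventually.of_forall fun ξ => ?_)
        show ‖Complex.exp (2 * π * I * (x + y * I) * ξ) * g ξ‖ ≤ Real.exp (2 * π * r * R) * ‖g ξ‖
        by_cases hξ : R < |ξ|
        · rw [hsupp ξ hξ]; simp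
        · push Not at hξ
          rw [norm_mul]
          refine mul_le_mul_of_nonneg_right ?_ (norm_nonneg _)
          rw [Complex.norm_exp, Real.exp_le_exp]
          have hre : (2 * π * I * (x + y * I) * ξ).re = -(2 * π * y * ξ) := by
            simp [Complex.mul_re, Complex.mul_im, Complex.add_re, Complex.add_im]
          rw [hre]
          have : -(y * ξ) ≤ r * R := by
            calc -(y * ξ) ≤ |y * ξ| := neg_le_abs _
              _ = |y| * |ξ| := abs_mul _ _
              _ ≤ r * R := mul_le_mul hy hξ (abs_nonneg _) hr
          nlinarith [Real.pi_pos]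
    _ = Real.exp (2 * π * r * R) * ∫ ξ, ‖g ξ‖ := integral_const_mul _ _

/-- **The `L²` norm on a horizontal line** (BD18 (3.14)): for `g ∈ L¹ ∩ L²` vanishing off
`[-R, R]`, `∫ |F(x+iy)|² dx = ∫ |e^{-2πyξ} g(ξ)|² dξ ≤ ∫ e^{4π|y||ξ|} |g(ξ)|² dξ` (Plancherel).
[cite: BourgainDyatlov2018, Lemma 3.2 (proof), (3.14)] -/
theorem integral_norm_sq_fourierLaplaceInv_line {g : ℝ → ℂ} (hg : Integrable g)
    (hg2 : MemLp g 2 volume) {R : ℝ} (hsupp : ∀ ξ, R < |ξ| → g ξ = 0) (y : ℝ) :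
    Integrable (fun x : ℝ => ‖∫ ξ : ℝ, Complex.exp (2 * π * I * (x + y * I) * ξ) * g ξ‖ ^ 2) ∧
    ∫ x : ℝ, ‖∫ ξ : ℝ, Complex.exp (2 * π * I * (x + y * I) * ξ) * g ξ‖ ^ 2 ≤
      ∫ ξ, Real.exp (4 * π * |y| * |ξ|) * ‖g ξ‖ ^ 2 := by
  -- the twisted function `e^{-2πyξ} g` is in `L¹ ∩ L²`
  set gy : ℝ → ℂ := fun ξ => (Real.exp (-(2 * π * y * ξ)) : ℂ) * g ξ with hgy
  have hw_bd : ∀ ξ, gy ξ = 0 ∨ ‖(Real.exp (-(2 * π * y * ξ)) : ℂ)‖ ≤ Real.exp (2 * π * |y| * R) := by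
    intro ξ
    by_cases hξ : R < |ξ|
    · left; simp [hgy, hsupp ξ hξ]
    · right
      push Not at hξ
      rw [Complex.norm_real, Real.norm_eq_abs, abs_of_pos (Real.exp_pos _), Real.exp_le_exp]
      have : -(y * ξ) ≤ |y| * R := by
        calc -(y * ξ) ≤ |y * ξ| := neg_le_abs _
          _ = |y| * |ξ| := abs_mul _ _
          _ ≤ |y| * R := mul_le_mul_of_nonneg_left hξ (abs_nonneg _)
      nlinarith [Real.pi_pos]
  have hgy_norm : ∀ ξ, ‖gy ξ‖ ≤ Real.exp (2 * π * |y| * R) * ‖g ξ‖ := by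
    intro ξ
    rcases hw_bd ξ with h | h
    · rw [h, norm_zero]; positivity
    · simp only [hgy, norm_mul]; exact mul_le_mul_of_nonneg_right h (norm_nonneg _)
  have hcont : Continuous fun ξ : ℝ => (Real.exp (-(2 * π * y * ξ)) : ℂ) :=
    Complex.continuous_ofReal.comp (Real.continuous_exp.comp (by fun_prop))
  have hgy_meas : AEStronglyMeasurable gy volume := hcont.aestronglyMeasurable.mul hg.aestronglyMeasurable
  have hgy1 : Integrable gy :=
    Integrable.mono' (hg.norm.const_mul _) hgy_meas (Eventually.of_forall hgy_norm)
  have hgy2 : MemLp gy 2 volume := by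
    refine ⟨hgy_meas, ?_⟩
    have h2 : eLpNorm gy 2 volume ≤ eLpNorm ((Real.exp (2 * π * |y| * R)) • g) 2 volume :=
      eLpNorm_mono fun ξ => by
        rw [Pi.smul_apply, norm_smul, Real.norm_of_nonneg (Real.exp_nonneg _)]; exact hgy_norm ξ
    have h3 : eLpNorm ((Real.exp (2 * π * |y| * R)) • g) 2 volume < ⊤ :=
      (hg2.const_smul (Real.exp (2 * π * |y| * R))).2
    exact h2.trans_lt h3
  have hfun : (fun x : ℝ => ‖∫ ξ : ℝ, Complex.exp (2 * π * I * (x + y * I) * ξ) * g ξ‖ ^ 2) =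
      fun x => ‖(𝓕⁻ gy : ℝ → ℂ) x‖ ^ 2 := by
    funext x; rw [fourierLaplaceInv_line g x y]
  refine ⟨?_, ?_⟩
  · rw [hfun]
    exact integrable_norm_sq_fourierInv hgy1 hgy2
  · rw [show (∫ x : ℝ, ‖∫ ξ : ℝ, Complex.exp (2 * π * I * (x + y * I) * ξ) * g ξ‖ ^ 2) =
        ∫ x, ‖(𝓕⁻ gy : ℝ → ℂ) x‖ ^ 2 from congrArg (fun F : ℝ → ℝ => ∫ x, F x) hfun,
      integral_norm_sq_fourierInv_eq hgy1 hgy2]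
    refine integral_mono_of_nonneg (Eventually.of_forall fun _ => sq_nonneg _) ?_
      (Eventually.of_forall fun ξ => ?_)
    · -- integrability of the majorant (on the support `|ξ| ≤ R`)
      have hmaj : ∀ ξ, Real.exp (4 * π * |y| * |ξ|) * ‖g ξ‖ ^ 2 ≤
          Real.exp (4 * π * |y| * R) * ‖g ξ‖ ^ 2 := by
        intro ξ
        by_cases hξ : R < |ξ|
        · rw [hsupp ξ hξ]; simp
        · push Not at hξ
          refine mul_le_mul_of_nonneg_right (Real.exp_le_exp.2 ?_) (sq_nonneg _)
          have := mul_le_mul_of_nonneg_left hξ (abs_nonneg y)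
          nlinarith [Real.pi_pos]
      refine Integrable.mono' ((hg2.integrable_norm_pow two_ne_zero).const_mul
        (Real.exp (4 * π * |y| * R))) ?_ (Eventually.of_forall fun ξ => ?_)
      · exact ((Real.continuous_exp.comp (by fun_prop)).aestronglyMeasurable).mul
          (hg.aestronglyMeasurable.norm.pow 2)
      · rw [Real.norm_of_nonneg (by positivity)]; exact hmaj ξ
    · show ‖gy ξ‖ ^ 2 ≤ Real.exp (4 * π * |y| * |ξ|) * ‖g ξ‖ ^ 2
      simp only [hgy, norm_mul, Complex.norm_real, Real.norm_eq_abs, abs_of_pos (Real.exp_pos _)]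
      rw [mul_pow, ← Real.exp_nat_mul]
      refine mul_le_mul_of_nonneg_right (Real.exp_le_exp.2 ?_) (sq_nonneg _)
      push_cast
      have : -(y * ξ) ≤ |y| * |ξ| := by
        calc -(y * ξ) ≤ |y * ξ| := neg_le_abs _
          _ = |y| * |ξ| := abs_mul _ _
      nlinarith [Real.pi_pos]

/-- `interpolation_of_log_subMeanValue` for measures given by densities on `ℝ` (the form in
which the harmonic measure of the slit strip enters BD18 (3.15)–(3.17): `dμ_t = ρ dμ_L` on the
slit and on the lines, Lemmas 2.13–2.14). [cite: BourgainDyatlov2018, Lemma 3.2 (proof), (3.15)] -/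
theorem interpolation_of_log_subMeanValue_density {ρ₀ ρ₁ ρ₂ : ℝ → ℝ}
    (hρ₀ : ∀ x, 0 ≤ ρ₀ x) (hρ₁ : ∀ x, 0 ≤ ρ₁ x) (hρ₂ : ∀ x, 0 ≤ ρ₂ x)
    (hρ₀m : Measurable ρ₀) (hρ₁m : Measurable ρ₁) (hρ₂m : Measurable ρ₂)
    (hρ₀i : Integrable ρ₀) (hρ₁i : Integrable ρ₁) (hρ₂i : Integrable ρ₂)
    (hmass : (∫ x, ρ₀ x) + (∫ x, ρ₁ x) + (∫ x, ρ₂ x) = 1)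
    {κ : ℝ} (hκ0 : 0 < κ) (hκ : κ ≤ ∫ x, ρ₀ x)
    {h H₁ H₂ : ℝ → ℝ} (hh0 : ∀ x, 0 ≤ h x) (hH₁0 : ∀ y, 0 ≤ H₁ y) (hH₂0 : ∀ y, 0 ≤ H₂ y)
    {M : ℝ} (hhM : ∀ x, h x ≤ M) (hH₁M : ∀ y, H₁ y ≤ M) (hH₂M : ∀ y, H₂ y ≤ M)
    (hhm : Measurable h) (hH₁m : Measurable H₁) (hH₂m : Measurable H₂) {X : ℝ} (hX : 0 ≤ X)
    (hsub : ∀ ε : ℝ, 0 < ε → ε ≤ 1 → Real.log (X + ε) ≤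
      (∫ x, Real.log (h x ^ 2 + ε) * ρ₀ x) +
        ((∫ y, Real.log (H₁ y + ε) * ρ₁ y) + ∫ y, Real.log (H₂ y + ε) * ρ₂ y)) :
    X ≤ 10 * ((∫ x, h x ^ (1 / 2 : ℝ) * ρ₀ x) ^ (4 * κ) *
      ((∫ x, h x ^ (1 / 2 : ℝ) * ρ₀ x) ^ 4 + ((∫ y, H₁ y * ρ₁ y) + ∫ y, H₂ y * ρ₂ y)) ^ (1 - κ)) := by
  -- the measures `νᵢ = ρᵢ dx`
  set ν₀ : Measure ℝ := volume.withDensity fun x => ENNReal.ofReal (ρ₀ x) with hν₀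
  set ν₁ : Measure ℝ := volume.withDensity fun x => ENNReal.ofReal (ρ₁ x) with hν₁
  set ν₂ : Measure ℝ := volume.withDensity fun x => ENNReal.ofReal (ρ₂ x) with hν₂
  haveI : IsFiniteMeasure ν₀ := isFiniteMeasure_withDensity_ofReal hρ₀i.2
  haveI : IsFiniteMeasure ν₁ := isFiniteMeasure_withDensity_ofReal hρ₁i.2
  haveI : IsFiniteMeasure ν₂ := isFiniteMeasure_withDensity_ofReal hρ₂i.2
  -- integrals against `νᵢ`
  have hint : ∀ {ρ : ℝ → ℝ}, (∀ x, 0 ≤ ρ x) → Measurable ρ → ∀ u : ℝ → ℝ,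
      ∫ x, u x ∂(volume.withDensity fun x => ENNReal.ofReal (ρ x)) = ∫ x, u x * ρ x := by
    intro ρ hρ hρm u
    rw [integral_withDensity_eq_integral_toReal_smul hρm.ennreal_ofReal
      (Eventually.of_forall fun _ => ENNReal.ofReal_lt_top)]
    refine integral_congr_ae (Eventually.of_forall fun x => ?_)
    show (ENNReal.ofReal (ρ x)).toReal • u x = u x * ρ x
    rw [ENNReal.toReal_ofReal (hρ x), smul_eq_mul, mul_comm]
  have hmass' : ∀ {ρ : ℝ → ℝ}, (∀ x, 0 ≤ ρ x) → Measurable ρ → Integrable ρ →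
      (volume.withDensity fun x => ENNReal.ofReal (ρ x)).real univ = ∫ x, ρ x := by
    intro ρ hρ hρm hρi
    rw [measureReal_def, withDensity_apply _ MeasurableSet.univ, Measure.restrict_univ,
      ← ofReal_integral_eq_lintegral_ofReal hρi (Eventually.of_forall hρ),
      ENNReal.toReal_ofReal (integral_nonneg hρ)]
  have h0 := hmass' hρ₀ hρ₀m hρ₀i
  have h1 := hmass' hρ₁ hρ₁m hρ₁i
  have h2 := hmass' hρ₂ hρ₂m hρ₂i
  have key := interpolation_of_log_subMeanValue ν₀ ν₁ ν₂ (by rw [h0, h1, h2]; exact hmass) hκ0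
    (by rw [h0]; exact hκ) hh0 hH₁0 hH₂0 hhM hH₁M hH₂M hhm.aestronglyMeasurable
    hH₁m.aestronglyMeasurable hH₂m.aestronglyMeasurable hX (fun ε hε hε1 => by
      rw [hint hρ₀ hρ₀m, hint hρ₁ hρ₁m, hint hρ₂ hρ₂m]; exact hsub ε hε hε1)
  rw [hint hρ₀ hρ₀m, hint hρ₁ hρ₁m, hint hρ₂ hρ₂m] at key
  exact key

/-- The algebra from (3.15)–(3.17) to the per-point bound of BD18, proof of Lemma 3.2: if
`X ≤ 10 𝒜^{4κ}(𝒜⁴+ℬ)^{1-κ}`, `𝒜⁴ ≤ C A` ((3.16)) and `ℬ ≤ (2/r) B` ((3.17)), `0 < r < 1`, then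
`X ≤ 10 (max C 2 / r) A^κ (A+B)^{1-κ}`. [cite: BourgainDyatlov2018, Lemma 3.2 (proof)] -/
theorem pointwise_bound_algebra {X 𝒜 ℬ A B C r κ : ℝ} (h𝒜 : 0 ≤ 𝒜) (hℬ : 0 ≤ ℬ) (hA : 0 ≤ A)
    (hB : 0 ≤ B) (hC : 0 ≤ C) (hr0 : 0 < r) (hr1 : r ≤ 1) (hκ0 : 0 ≤ κ) (hκ1 : κ ≤ 1)
    (hX : X ≤ 10 * (𝒜 ^ (4 * κ) * (𝒜 ^ 4 + ℬ) ^ (1 - κ))) (h16 : 𝒜 ^ 4 ≤ C * A)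
    (h17 : ℬ ≤ 2 / r * B) :
    X ≤ 10 * (max C 2 / r) * (A ^ κ * (A + B) ^ (1 - κ)) := by
  set M : ℝ := max C 2 / r with hM
  have hM1 : C ≤ M := by
    rw [hM, le_div_iff₀ hr0]; nlinarith [le_max_left C 2]
  have hM2 : 2 / r ≤ M := div_le_div_of_nonneg_right (le_max_right C 2) hr0.le
  have hM0 : 0 ≤ M := by rw [hM]; positivity
  have h1 : 𝒜 ^ 4 ≤ M * A := h16.trans (mul_le_mul_of_nonneg_right hM1 hA)
  have h2 : 𝒜 ^ 4 + ℬ ≤ M * (A + B) := by nlinarith [mul_le_mul_of_nonneg_right hM2 hB]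
  have h3 : 𝒜 ^ (4 * κ) = (𝒜 ^ 4) ^ κ := by
    rw [← Real.rpow_natCast 𝒜 4, ← Real.rpow_mul h𝒜]; norm_num
  calc X ≤ 10 * (𝒜 ^ (4 * κ) * (𝒜 ^ 4 + ℬ) ^ (1 - κ)) := hX
    _ ≤ 10 * ((M * A) ^ κ * (M * (A + B)) ^ (1 - κ)) := by
        rw [h3]
        refine mul_le_mul_of_nonneg_left (mul_le_mul (Real.rpow_le_rpow (by positivity) h1 hκ0)
          (Real.rpow_le_rpow (by positivity) h2 (by linarith)) (Real.rpow_nonneg (by positivity) _)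
          (Real.rpow_nonneg (by positivity) _)) (by norm_num)
    _ = 10 * M * (A ^ κ * (A + B) ^ (1 - κ)) := by
        rw [Real.mul_rpow hM0 hA, Real.mul_rpow hM0 (by positivity)]
        have : M ^ κ * M ^ (1 - κ) = M := by
          rw [← Real.rpow_add' hM0 (by linarith)]; norm_num
        calc 10 * (M ^ κ * A ^ κ * (M ^ (1 - κ) * (A + B) ^ (1 - κ)))
            = 10 * (M ^ κ * M ^ (1 - κ)) * (A ^ κ * (A + B) ^ (1 - κ)) := by ring
          _ = 10 * M * (A ^ κ * (A + B) ^ (1 - κ)) := by rw [this]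

/-- **Hölder by weighted AM–GM** (the summation step `Σ a_j^κ b_j^{1-κ} ≤ (Σa_j)^κ(Σb_j)^{1-κ}`
of BD18 (2.14), in integral form): for integrable `0 ≤ A ≤ Q` on `ℝ` and `0 < κ < 1`,
`∫ A^κ Q^{1-κ} ≤ (∫A)^κ (∫Q)^{1-κ}`. [cite: BourgainDyatlov2018, (2.14)] -/
theorem integral_rpow_mul_rpow_le {A Q : ℝ → ℝ} (hA0 : ∀ t, 0 ≤ A t) (hAQ : ∀ t, A t ≤ Q t)
    (hAm : Measurable A) (hQm : Measurable Q) (hAi : Integrable A) (hQi : Integrable Q)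
    {κ : ℝ} (hκ0 : 0 < κ) (hκ1 : κ < 1) :
    Integrable (fun t => A t ^ κ * Q t ^ (1 - κ)) ∧
    ∫ t, A t ^ κ * Q t ^ (1 - κ) ≤ (∫ t, A t) ^ κ * (∫ t, Q t) ^ (1 - κ) := by
  have hQ0 : ∀ t, 0 ≤ Q t := fun t => (hA0 t).trans (hAQ t)
  -- pointwise domination `A^κ Q^{1-κ} ≤ Q`
  have hdom : ∀ t, A t ^ κ * Q t ^ (1 - κ) ≤ Q t := fun t => by
    calc A t ^ κ * Q t ^ (1 - κ) ≤ Q t ^ κ * Q t ^ (1 - κ) :=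
          mul_le_mul_of_nonneg_right (Real.rpow_le_rpow (hA0 t) (hAQ t) hκ0.le) (Real.rpow_nonneg (hQ0 t) _)
      _ = Q t := by rw [← Real.rpow_add' (hQ0 t) (by linarith)]; norm_num
  have hmeas : Measurable fun t => A t ^ κ * Q t ^ (1 - κ) :=
    (hAm.pow_const κ).mul (hQm.pow_const _)
  have hint : Integrable fun t => A t ^ κ * Q t ^ (1 - κ) :=
    hQi.mono' hmeas.aestronglyMeasurable (Eventually.of_forall fun t => by
      rw [Real.norm_of_nonneg (mul_nonneg (Real.rpow_nonneg (hA0 t) _) (Real.rpow_nonneg (hQ0 t) _))]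
      exact hdom t)
  refine ⟨hint, ?_⟩
  set P : ℝ := ∫ t, A t with hP
  set S : ℝ := ∫ t, Q t with hS
  have hP0 : 0 ≤ P := integral_nonneg hA0
  have hS0 : 0 ≤ S := integral_nonneg hQ0
  rcases hP0.eq_or_lt with hPz | hPpos
  · -- `∫ A = 0`: then `A = 0` a.e. and the left side vanishes
    have hAae : A =ᵐ[volume] 0 := (integral_eq_zero_iff_of_nonneg hA0 hAi).1 hPz.symm
    have : ∫ t, A t ^ κ * Q t ^ (1 - κ) = 0 := by
      refine integral_eq_zero_of_ae ?_
      filter_upwards [hAae] with t ht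
      simp [ht, Real.zero_rpow hκ0.ne']
    rw [this, ← hPz, Real.zero_rpow hκ0.ne', zero_mul]
  have hSpos : 0 < S := by
    have : P ≤ S := integral_mono hAi hQi hAQ
    linarith
  -- normalise and apply AM–GM pointwise: `(A/P)^κ (Q/S)^{1-κ} ≤ κ A/P + (1-κ) Q/S`
  have hpt : ∀ t, A t ^ κ * Q t ^ (1 - κ) ≤ P ^ κ * S ^ (1 - κ) * (κ * (A t / P) + (1 - κ) * (Q t / S)) := by
    intro t
    have h := Real.geom_mean_le_arith_mean2_weighted (w₁ := κ) (w₂ := 1 - κ) (p₁ := A t / P)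
      (p₂ := Q t / S) hκ0.le (by linarith) (div_nonneg (hA0 t) hP0) (div_nonneg (hQ0 t) hS0) (by ring)
    have e1 : (A t / P) ^ κ = A t ^ κ / P ^ κ := Real.div_rpow (hA0 t) hP0 κ
    have e2 : (Q t / S) ^ (1 - κ) = Q t ^ (1 - κ) / S ^ (1 - κ) := Real.div_rpow (hQ0 t) hS0 _
    rw [e1, e2] at h
    have hPκ : 0 < P ^ κ := Real.rpow_pos_of_pos hPpos κ
    have hSκ : 0 < S ^ (1 - κ) := Real.rpow_pos_of_pos hSpos _
    have := mul_le_mul_of_nonneg_left h (le_of_lt (mul_pos hPκ hSκ))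
    calc A t ^ κ * Q t ^ (1 - κ) = P ^ κ * S ^ (1 - κ) * (A t ^ κ / P ^ κ * (Q t ^ (1 - κ) / S ^ (1 - κ))) := by
          field_simp
      _ ≤ _ := this
  have hrhs_int : Integrable fun t => P ^ κ * S ^ (1 - κ) * (κ * (A t / P) + (1 - κ) * (Q t / S)) :=
    (((hAi.div_const P).const_mul κ).add ((hQi.div_const S).const_mul (1 - κ))).const_mul _
  calc ∫ t, A t ^ κ * Q t ^ (1 - κ)
      ≤ ∫ t, P ^ κ * S ^ (1 - κ) * (κ * (A t / P) + (1 - κ) * (Q t / S)) :=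
        integral_mono hint hrhs_int hpt
    _ = P ^ κ * S ^ (1 - κ) * (κ * ((∫ t, A t) / P) + (1 - κ) * ((∫ t, Q t) / S)) := by
        rw [integral_const_mul, integral_add ((hAi.div_const P).const_mul κ)
          ((hQi.div_const S).const_mul (1 - κ)), integral_const_mul, integral_const_mul,
          integral_div, integral_div]
    _ = P ^ κ * S ^ (1 - κ) := by rw [← hP, ← hS]; field_simp; ring

/-- **Tonelli with a kernel bounded in `t`**: if `∫ k(t, x) dt ≤ K` for every `x`, then
`∫∫ k(t,x) w(x) dx dt ≤ K ∫ w` (used twice in the proof of BD18 Lemma 3.2: for the slit terms,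
"integrating in `t ∈ I ∖ I''`", and for the line terms, `Σ_I e^{-d(Re z, I)} ≤ C`). [folklore] -/
theorem lintegral_lintegral_kernel_le {k : ℝ → ℝ → ℝ≥0∞} (hk : Measurable (Function.uncurry k))
    {K : ℝ≥0∞} (hK : ∀ x, ∫⁻ t, k t x ≤ K) {w : ℝ → ℝ≥0∞} (hw : Measurable w) :
    ∫⁻ t, ∫⁻ x, k t x * w x ≤ K * ∫⁻ x, w x := by
  have hmeas : AEMeasurable (Function.uncurry fun t x => k t x * w x) (volume.prod volume) :=
    (hk.mul (hw.comp measurable_snd)).aemeasurable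
  rw [lintegral_lintegral_swap hmeas]
  calc ∫⁻ x, ∫⁻ t, k t x * w x = ∫⁻ x, w x * ∫⁻ t, k t x := by
        refine lintegral_congr fun x => ?_
        rw [lintegral_mul_const _ (show Measurable (fun t => k t x) from
          hk.comp (measurable_id.prodMk measurable_const)), mul_comm]
    _ ≤ ∫⁻ x, w x * K := lintegral_mono fun x => mul_le_mul_of_nonneg_left (hK x) zero_le
    _ = K * ∫⁻ x, w x := by rw [lintegral_mul_const _ hw, mul_comm]

/-- The slit kernel integrates to at most `2` in `t`: for cells `I''_j ⊂ [j, j+1]`, the set of `t`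
whose cell `I''_{⌊t⌋}` contains a given `x` lies in `[⌊x⌋-1, ⌊x⌋+1)`. [cite: BourgainDyatlov2018, Lemma 3.2 (proof)] -/
theorem volume_setOf_mem_cell_floor_le {s : ℤ → ℝ} {c : ℝ}
    (hs : ∀ j : ℤ, Icc (s j - c) (s j + c) ⊆ Icc (j : ℝ) (j + 1)) (x : ℝ) :
    volume {t : ℝ | x ∈ Icc (s ⌊t⌋ - c) (s ⌊t⌋ + c)} ≤ 2 := by
  have hsub : {t : ℝ | x ∈ Icc (s ⌊t⌋ - c) (s ⌊t⌋ + c)} ⊆ Ico ((⌊x⌋ : ℝ) - 1) (⌊x⌋ + 1) := by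
    intro t ht
    have hx := hs ⌊t⌋ ht
    -- `⌊t⌋ ≤ x ≤ ⌊t⌋ + 1` forces `⌊t⌋ ∈ {⌊x⌋ - 1, ⌊x⌋}`
    have h1 : ⌊t⌋ ≤ ⌊x⌋ := Int.le_floor.2 hx.1
    have h2 : ⌊x⌋ ≤ ⌊t⌋ + 1 := by
      have : ⌊x⌋ ≤ ⌊((⌊t⌋ : ℝ) + 1)⌋ := Int.floor_mono hx.2
      rwa [show ((⌊t⌋ : ℝ) + 1) = ((⌊t⌋ + 1 : ℤ) : ℝ) by push_cast; ring, Int.floor_intCast] at this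
    have ht1 : ((⌊t⌋ : ℤ) : ℝ) ≤ t := Int.floor_le t
    have ht2 : t < (⌊t⌋ : ℝ) + 1 := Int.lt_floor_add_one t
    have h1' : ((⌊t⌋ : ℤ) : ℝ) ≤ ⌊x⌋ := by exact_mod_cast h1
    have h2' : ((⌊x⌋ : ℤ) : ℝ) ≤ ⌊t⌋ + 1 := by exact_mod_cast h2
    constructor <;> linarith
  calc volume {t : ℝ | x ∈ Icc (s ⌊t⌋ - c) (s ⌊t⌋ + c)} ≤ volume (Ico ((⌊x⌋ : ℝ) - 1) (⌊x⌋ + 1)) :=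
        measure_mono hsub
    _ = 2 := by rw [Real.volume_Ico]; norm_num

/-- The line kernel integrates to at most `2e` in `t`: `∫ e^{1-|x-t|} dt = 2e`.
[cite: BourgainDyatlov2018, Lemma 3.2 (proof)] -/
theorem lintegral_exp_one_sub_abs_le (x : ℝ) :
    ∫⁻ t, ENNReal.ofReal (Real.exp (1 - |x - t|)) ≤ ENNReal.ofReal (2 * Real.exp 1) := by
  have h0 : Integrable fun u : ℝ => Real.exp (-|u|) := by
    have := Literature.Analysis.Complex.integrable_exp_neg_mul_abs one_pos
    simpa using this
  have h1 : Integrable fun t : ℝ => Real.exp (-|x - t|) := h0.comp_sub_left x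
  have h2 : Integrable fun t : ℝ => Real.exp (1 - |x - t|) := by
    have := h1.const_mul (Real.exp 1)
    refine this.congr (Eventually.of_forall fun t => ?_)
    show Real.exp 1 * Real.exp (-|x - t|) = Real.exp (1 - |x - t|)
    rw [← Real.exp_add]; ring_nf
  rw [← ofReal_integral_eq_lintegral_ofReal h2 (Eventually.of_forall fun _ => (Real.exp_pos _).le)]
  refine ENNReal.ofReal_le_ofReal (le_of_eq ?_)
  have hval : ∫ u : ℝ, Real.exp (-|u|) = 2 := by
    rw [integral_comp_abs (f := fun v => Real.exp (-v)), integral_exp_neg_Ioi_zero]; norm_num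
  calc ∫ t, Real.exp (1 - |x - t|) = ∫ t, Real.exp 1 * Real.exp (-|x - t|) := by
        refine integral_congr_ae (Eventually.of_forall fun t => ?_)
        show Real.exp (1 - |x - t|) = Real.exp 1 * Real.exp (-|x - t|)
        rw [← Real.exp_add]; ring_nf
    _ = Real.exp 1 * ∫ t, Real.exp (-|x - t|) := integral_const_mul _ _
    _ = Real.exp 1 * ∫ u, Real.exp (-|u|) := by
        rw [integral_sub_left_eq_self (fun u => Real.exp (-|u|)) volume x]
    _ = 2 * Real.exp 1 := by rw [hval]; ring


set_option maxHeartbeats 800000 in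
/-- **BD18 Lemma 3.2 ("A bound on functions with compact Fourier support") from the
harmonic-measure facts of BD18 §2.4**, for the tiling `𝓘 = {[j, j+1]}` and subintervals
`I''_j = [s_j - c₀/2, s_j + c₀/2] ⊂ [j, j+1]` of size `c₀` (the case used in §3.3), written for
`f = 𝓕⁻ g`, `g ∈ L¹ ∩ L²` with compact support (so `‖e^{2πr|ξ|}f̂‖²_{L²} = ∫ e^{4πr|ξ|}|g|²` and
`Σ_I ‖f‖²_{L²(I)} = ‖f‖²_{L²}`): there is `C = C(c₀)` such that for `0 < r < 1`,
`0 < κ ≤ e^{-C/r}`, `‖f‖²_{L²} ≤ (C/r) ‖f‖_{L²(U'')}^{2κ} ‖e^{2πr|ξ|} f̂‖_{L²}^{2(1-κ)}`,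
`U'' = ⋃ I''_j`. The §2.4 input is the explicit hypothesis `h24`: for each slit strip
`Σ = {|Im z| < r} ∖ I₀`, `I₀ = [a, a+ℓ]`, `0 < ℓ ≤ 1`, and each real `t` with
`ℓ/10 ≤ d(t, I₀) ≤ 1`, the harmonic measure `μ_t` is given by densities `ρ₀` (on `I₀`, both
sides of the slit together), `ρ₁, ρ₂` (on the lines `Im z = ±r`) of total mass one, with
Lemma 2.12 ((2.10), for the bounded subharmonic functions `log(|F|²+ε)`, `F` entire and bounded
on the closed strip), Lemma 2.13 ((2.11) with `p = 4/3`, in the dual form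
`(∫ u ρ₀)⁴ ≤ C_ℓ ∫_{I₀} u⁴` given by Hölder's inequality, which is how (3.16) uses it),
Lemma 2.14 ((2.12): `ρ₁, ρ₂ ≤ (2/r)e^{-d(x, I₀)}`) and Lemma 2.15 ((2.13):
`μ_t(I₀) ≥ (ℓ/4)e^{-2/r}`, both copies of `I₀` together). The proof is the printed one:
holomorphic extension `F`, (3.14), the per-point interpolation (3.15)–(3.17)
(`interpolation_of_log_subMeanValue`), integration in `t` and Hölder (here by AM–GM), and the
bounded overlap `Σ_I e^{-d(Re z, I)} ≤ C` (here `∫ e^{1-|x-t|}dt = 2e`).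
[cite: BourgainDyatlov2018, Lemma 3.2] -/
theorem lemma32_of_harmonicMeasure
    (h24 : ∀ ℓ : ℝ, 0 < ℓ → ℓ ≤ 1 → ∃ Cℓ : ℝ, 0 < Cℓ ∧
      ∀ (a r t : ℝ), 0 < r → r < 1 → (t ≤ a - ℓ / 10 ∨ a + ℓ + ℓ / 10 ≤ t) →
        a - 1 ≤ t → t ≤ a + ℓ + 1 →
        ∃ (ρ₀ ρ₁ ρ₂ : ℝ → ℝ), (∀ x, 0 ≤ ρ₀ x) ∧ (∀ x, 0 ≤ ρ₁ x) ∧ (∀ x, 0 ≤ ρ₂ x) ∧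
          Measurable ρ₀ ∧ Measurable ρ₁ ∧ Measurable ρ₂ ∧
          Integrable ρ₀ ∧ Integrable ρ₁ ∧ Integrable ρ₂ ∧
          (∀ x, x ∉ Icc a (a + ℓ) → ρ₀ x = 0) ∧
          (∫ x, ρ₀ x) + (∫ x, ρ₁ x) + (∫ x, ρ₂ x) = 1 ∧
          ℓ / 4 * Real.exp (-2 / r) ≤ ∫ x, ρ₀ x ∧
          (∀ u : ℝ → ℝ, (∀ x, 0 ≤ u x) → Measurable u → (∃ B, ∀ x, u x ≤ B) →
            (∫ x, u x * ρ₀ x) ^ 4 ≤ Cℓ * ∫ x in Icc a (a + ℓ), u x ^ 4) ∧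
          (∀ x, ρ₁ x ≤ 2 / r * Real.exp (-(max (a - x) (max (x - (a + ℓ)) 0)))) ∧
          (∀ x, ρ₂ x ≤ 2 / r * Real.exp (-(max (a - x) (max (x - (a + ℓ)) 0)))) ∧
          ∀ F : ℂ → ℂ, Differentiable ℂ F → (∃ B, ∀ z : ℂ, |z.im| ≤ r → ‖F z‖ ≤ B) →
            ∀ ε : ℝ, 0 < ε →
              Real.log (‖F t‖ ^ 2 + ε) ≤ (∫ x : ℝ, Real.log (‖F x‖ ^ 2 + ε) * ρ₀ x) +
                ((∫ x : ℝ, Real.log (‖F (x + r * I)‖ ^ 2 + ε) * ρ₁ x) +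
                  ∫ x : ℝ, Real.log (‖F (x - r * I)‖ ^ 2 + ε) * ρ₂ x))
    {c₀ : ℝ} (hc₀ : 0 < c₀) (hc₀1 : c₀ ≤ 1) :
    ∃ C : ℝ, 0 < C ∧ ∀ (r κ : ℝ), 0 < r → r < 1 → 0 < κ → κ ≤ Real.exp (-C / r) →
      ∀ s : ℤ → ℝ, (∀ j : ℤ, Icc (s j - c₀ / 2) (s j + c₀ / 2) ⊆ Icc (j : ℝ) (j + 1)) →
      ∀ g : ℝ → ℂ, Integrable g → MemLp g 2 volume → ∀ R : ℝ, (∀ ξ, R < |ξ| → g ξ = 0) →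
        ∫ x, ‖(𝓕⁻ g : ℝ → ℂ) x‖ ^ 2 ≤
          C / r * (∫ x in ⋃ j : ℤ, Icc (s j - c₀ / 2) (s j + c₀ / 2), ‖(𝓕⁻ g : ℝ → ℂ) x‖ ^ 2) ^ κ *
            (∫ ξ, Real.exp (4 * π * r * |ξ|) * ‖g ξ‖ ^ 2) ^ (1 - κ) := by
  -- constants
  obtain ⟨Cℓ, hCℓpos, hHM⟩ := h24 (c₀ / 2) (by positivity) (by linarith)
  set Mℓ : ℝ := max Cℓ 2 with hMℓ
  have hMℓ0 : 0 < Mℓ := lt_max_of_lt_right two_pos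
  set Cbig : ℝ := 1 + 20 * Mℓ * (2 + 4 * Real.exp 1) with hCbig
  have hCbig1 : 1 ≤ Cbig := by rw [hCbig]; have := Real.exp_pos 1; nlinarith
  set C : ℝ := max (2 + Real.log (8 / c₀)) Cbig with hC
  have hlog0 : 0 ≤ Real.log (8 / c₀) := Real.log_nonneg (by rw [le_div_iff₀ hc₀]; linarith)
  have hC2 : 2 + Real.log (8 / c₀) ≤ C := le_max_left _ _
  have hCb : Cbig ≤ C := le_max_right _ _
  have hCpos : 0 < C := by linarith
  refine ⟨C, hCpos, ?_⟩
  intro r κ hr0 hr1 hκ0 hκC s hs g hg1 hg2 R hsupp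
  -- `κ ≤ (c₀/8) e^{-2/r} ≤ 1`
  have hκmass : κ ≤ c₀ / 8 * Real.exp (-2 / r) := by
    refine hκC.trans ?_
    have h1 : -C / r ≤ Real.log (c₀ / 8) + (-2 / r) := by
      have hC2' : (2 + Real.log (8 / c₀)) / r ≤ C / r := div_le_div_of_nonneg_right hC2 hr0.le
      have hlr : Real.log (8 / c₀) ≤ Real.log (8 / c₀) / r := by
        rw [le_div_iff₀ hr0]; nlinarith
      have : Real.log (c₀ / 8) = -Real.log (8 / c₀) := by
        rw [← Real.log_inv]; congr 1; field_simp
      rw [this, neg_div, neg_div]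
      have e : (2 + Real.log (8 / c₀)) / r = 2 / r + Real.log (8 / c₀) / r := by ring
      linarith
    calc Real.exp (-C / r) ≤ Real.exp (Real.log (c₀ / 8) + -2 / r) := Real.exp_le_exp.2 h1
      _ = c₀ / 8 * Real.exp (-2 / r) := by rw [Real.exp_add, Real.exp_log (by positivity)]
  have hκ1 : κ < 1 := by
    have h1 : Real.exp (-C / r) < 1 := by
      rw [Real.exp_lt_one_iff, neg_div]; exact neg_neg_of_pos (div_pos hCpos hr0)
    linarith
  -- the function `f = 𝓕⁻ g` and its holomorphic extension `F`
  set f : ℝ → ℂ := (𝓕⁻ g : ℝ → ℂ) with hf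
  set F : ℂ → ℂ := fun z => ∫ ξ : ℝ, Complex.exp (2 * π * I * z * ξ) * g ξ with hF
  have hFdiff : Differentiable ℂ F := differentiable_fourierLaplaceInv hg1 (le_max_right R 0)
    (fun ξ hξ => hsupp ξ ((le_max_left R 0).trans_lt hξ))
  have hFcont : Continuous F := hFdiff.continuous
  have hFreal : ∀ x : ℝ, F x = f x := fun x => fourierLaplaceInv_ofReal g x
  set B₀ : ℝ := ∫ ξ, ‖g ξ‖ with hB₀
  have hB₀0 : 0 ≤ B₀ := integral_nonneg fun _ => norm_nonneg _
  have hfbd : ∀ x, ‖f x‖ ≤ B₀ := fun x =>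
    VectorFourier.norm_fourierIntegral_le_integral_norm 𝐞 volume (-innerₗ ℝ) g x
  set Bst : ℝ := Real.exp (2 * π * r * max R 0) * B₀ with hBst
  have hFstrip : ∀ z : ℂ, |z.im| ≤ r → ‖F z‖ ≤ Bst := by
    intro z hz
    have h := norm_fourierLaplaceInv_le hg1 (R := max R 0)
      (fun ξ hξ => hsupp ξ ((le_max_left R 0).trans_lt hξ)) hr0.le z.re z.im hz
    have hz' : ((z.re : ℂ) + (z.im : ℂ) * I) = z := Complex.re_add_im z
    simp only [hF]
    rw [← hz']
    exact h
  have hfcont : Continuous f := by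
    have : f = fun x : ℝ => F x := funext fun x => (hFreal x).symm
    rw [this]; exact hFcont.comp Complex.continuous_ofReal
  -- Plancherel and the weighted energy `E`
  set E : ℝ := ∫ ξ, Real.exp (4 * π * r * |ξ|) * ‖g ξ‖ ^ 2 with hE
  have hg2i : Integrable (fun ξ => ‖g ξ‖ ^ 2) := hg2.integrable_norm_pow two_ne_zero
  have hEi : Integrable (fun ξ => Real.exp (4 * π * r * |ξ|) * ‖g ξ‖ ^ 2) := by
    refine (hg2i.const_mul (Real.exp (4 * π * r * max R 0))).mono' ?_ (Eventually.of_forall fun ξ => ?_)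
    · exact ((Real.continuous_exp.comp (by fun_prop)).aestronglyMeasurable).mul
        (hg1.aestronglyMeasurable.norm.pow 2)
    · rw [Real.norm_of_nonneg (by positivity)]
      by_cases hξ : max R 0 < |ξ|
      · rw [hsupp ξ ((le_max_left R 0).trans_lt hξ)]; simp
      · push Not at hξ
        refine mul_le_mul_of_nonneg_right (Real.exp_le_exp.2 ?_) (sq_nonneg _)
        have := mul_le_mul_of_nonneg_left hξ hr0.le
        nlinarith [Real.pi_pos]
  have hPl : ∫ x, ‖f x‖ ^ 2 = ∫ ξ, ‖g ξ‖ ^ 2 := integral_norm_sq_fourierInv_eq hg1 hg2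
  have hf2i : Integrable (fun x => ‖f x‖ ^ 2) := integrable_norm_sq_fourierInv hg1 hg2
  have hgE : ∫ ξ, ‖g ξ‖ ^ 2 ≤ E := by
    refine integral_mono hg2i hEi fun ξ => ?_
    have : 1 ≤ Real.exp (4 * π * r * |ξ|) := Real.one_le_exp (by positivity)
    nlinarith [sq_nonneg ‖g ξ‖]
  have hfE : ∫ x, ‖f x‖ ^ 2 ≤ E := hPl ▸ hgE
  have hE0 : 0 ≤ E := le_trans (integral_nonneg fun _ => sq_nonneg _) hfE
  -- the line functions
  set H₁ : ℝ → ℝ := fun x => ‖F (x + r * I)‖ ^ 2 with hH₁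
  set H₂ : ℝ → ℝ := fun x => ‖F (x - r * I)‖ ^ 2 with hH₂
  have hH₁0 : ∀ x, 0 ≤ H₁ x := fun x => sq_nonneg _
  have hH₂0 : ∀ x, 0 ≤ H₂ x := fun x => sq_nonneg _
  have hH₁bd : ∀ x, H₁ x ≤ Bst ^ 2 := fun x =>
    pow_le_pow_left₀ (norm_nonneg _) (hFstrip _ (by
      rw [show (((x : ℝ) : ℂ) + ((r : ℝ) : ℂ) * I).im = r by simp, abs_of_pos hr0])) 2
  have hH₂bd : ∀ x, H₂ x ≤ Bst ^ 2 := fun x =>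
    pow_le_pow_left₀ (norm_nonneg _) (hFstrip _ (by
      rw [show (((x : ℝ) : ℂ) - ((r : ℝ) : ℂ) * I).im = -r by simp, abs_neg, abs_of_pos hr0])) 2
  have hH₁c : Continuous H₁ := ((hFcont.comp (by fun_prop)).norm).pow 2
  have hH₂c : Continuous H₂ := ((hFcont.comp (by fun_prop)).norm).pow 2
  have hline : ∀ y : ℝ, |y| = r →
      Integrable (fun x : ℝ => ‖F (x + y * I)‖ ^ 2) ∧ ∫ x : ℝ, ‖F (x + y * I)‖ ^ 2 ≤ E := by
    intro y hy
    have h := integral_norm_sq_fourierLaplaceInv_line hg1 hg2 (R := max R 0)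
      (fun ξ hξ => hsupp ξ ((le_max_left R 0).trans_lt hξ)) y
    rw [hy] at h
    exact ⟨h.1, h.2⟩
  have hH₁i : Integrable H₁ := (hline r (abs_of_pos hr0)).1
  have hH₁E : ∫ x, H₁ x ≤ E := (hline r (abs_of_pos hr0)).2
  have hH₂i : Integrable H₂ := by
    have h := (hline (-r) (by rw [abs_neg, abs_of_pos hr0])).1
    refine h.congr (Eventually.of_forall fun x => ?_)
    show ‖F (x + ((-r : ℝ) : ℂ) * I)‖ ^ 2 = H₂ x
    simp only [hH₂, Complex.ofReal_neg, neg_mul, ← sub_eq_add_neg]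
  have hH₂E : ∫ x, H₂ x ≤ E := by
    have h := (hline (-r) (by rw [abs_neg, abs_of_pos hr0])).2
    refine le_trans (le_of_eq (integral_congr_ae (Eventually.of_forall fun x => ?_))) h
    show H₂ x = ‖F (x + ((-r : ℝ) : ℂ) * I)‖ ^ 2
    simp only [hH₂, Complex.ofReal_neg, neg_mul, ← sub_eq_add_neg]
  -- per-cell quantities
  set U : Set ℝ := ⋃ j : ℤ, Icc (s j - c₀ / 2) (s j + c₀ / 2) with hU
  have hUm : MeasurableSet U := MeasurableSet.iUnion fun _ => measurableSet_Icc
  set Aj : ℤ → ℝ := fun j => ∫ x in Icc (s j - c₀ / 2) (s j + c₀ / 2), ‖f x‖ ^ 2 with hAj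
  set dj : ℤ → ℝ → ℝ := fun j x =>
    max (s j - c₀ / 4 - x) (max (x - (s j - c₀ / 4 + c₀ / 2)) 0) with hdj
  set Bj : ℤ → ℝ := fun j => ∫ x, Real.exp (-(dj j x)) * (H₁ x + H₂ x) with hBj
  have hAj0 : ∀ j, 0 ≤ Aj j := fun j => integral_nonneg fun _ => sq_nonneg _
  have hdj0 : ∀ j x, 0 ≤ dj j x := fun j x => le_max_of_le_right (le_max_right _ _)
  have hexpd : ∀ j x, Real.exp (-(dj j x)) ≤ 1 := fun j x => by
    rw [Real.exp_le_one_iff]; linarith [hdj0 j x]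
  have hdjc : ∀ j, Continuous (dj j) := fun j => by simp only [hdj]; fun_prop
  have hBint : ∀ j, Integrable fun x => Real.exp (-(dj j x)) * (H₁ x + H₂ x) := fun j =>
    (hH₁i.add hH₂i).bdd_mul ((Real.continuous_exp.comp (hdjc j).neg).aestronglyMeasurable)
      (Eventually.of_forall fun x => by
        rw [Real.norm_of_nonneg (Real.exp_nonneg _)]; exact hexpd j x)
  have hBj0 : ∀ j, 0 ≤ Bj j := fun j => integral_nonneg fun x => mul_nonneg (Real.exp_nonneg _)
    (add_nonneg (hH₁0 x) (hH₂0 x))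
  ----------------------------------------------------------------
  -- Step 1: the per-point bound off `U`
  ----------------------------------------------------------------
  have hpt : ∀ t : ℝ, t ∉ U →
      ‖f t‖ ^ 2 ≤ 10 * (Mℓ / r) * (Aj ⌊t⌋ ^ κ * (Aj ⌊t⌋ + Bj ⌊t⌋) ^ (1 - κ)) := by
    intro t htU
    set j : ℤ := ⌊t⌋ with hj
    have hsj := hs j
    have hsj1 : (j : ℝ) ≤ s j - c₀ / 2 := (hsj (left_mem_Icc.2 (by linarith))).1
    have hsj2 : s j + c₀ / 2 ≤ j + 1 := (hsj (right_mem_Icc.2 (by linarith))).2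
    have ht1 : (j : ℝ) ≤ t := Int.floor_le t
    have ht2 : t < j + 1 := Int.lt_floor_add_one t
    have htI : t < s j - c₀ / 2 ∨ s j + c₀ / 2 < t := by
      by_contra hcon
      push Not at hcon
      exact htU (Set.mem_iUnion.2 ⟨j, hcon.1, hcon.2⟩)
    -- the harmonic-measure data for `I₀ = [s j - c₀/4, s j + c₀/4]`, `ℓ = c₀/2`
    set a : ℝ := s j - c₀ / 4 with ha
    obtain ⟨ρ₀, ρ₁, ρ₂, hρ₀0, hρ₁0, hρ₂0, hρ₀m, hρ₁m, hρ₂m, hρ₀i, hρ₁i, hρ₂i, hρ₀supp, hmass,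
      h215, h213, h214a, h214b, h212⟩ := hHM a r t hr0 hr1
        (by rcases htI with h | h <;> [left; right] <;> [linarith; linarith])
        (by linarith) (by linarith)
    -- the interpolation inequality
    have hκρ : κ ≤ ∫ x, ρ₀ x := hκmass.trans (by
      have : c₀ / 2 / 4 * Real.exp (-2 / r) ≤ ∫ x, ρ₀ x := h215
      linarith [show c₀ / 2 / 4 * Real.exp (-2 / r) = c₀ / 8 * Real.exp (-2 / r) by ring])
    set M : ℝ := max B₀ (Bst ^ 2) with hM
    have hint := interpolation_of_log_subMeanValue_density hρ₀0 hρ₁0 hρ₂0 hρ₀m hρ₁m hρ₂m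
      hρ₀i hρ₁i hρ₂i hmass hκ0 hκρ (h := fun x => ‖f x‖) (H₁ := H₁) (H₂ := H₂)
      (fun x => norm_nonneg _) hH₁0 hH₂0 (M := M) (fun x => (hfbd x).trans (le_max_left _ _))
      (fun x => (hH₁bd x).trans (le_max_right _ _)) (fun x => (hH₂bd x).trans (le_max_right _ _))
      hfcont.norm.measurable hH₁c.measurable hH₂c.measurable (X := ‖f t‖ ^ 2) (sq_nonneg _)
      (fun ε hε _ => by
        have h := h212 F hFdiff ⟨Bst, hFstrip⟩ ε hε
        rw [hFreal t] at h
        refine h.trans (le_of_eq ?_)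
        congr 1
        · refine integral_congr_ae (Eventually.of_forall fun x => ?_)
          show Real.log (‖F x‖ ^ 2 + ε) * ρ₀ x = Real.log (‖f x‖ ^ 2 + ε) * ρ₀ x
          rw [hFreal x])
    -- (3.16): `𝒜⁴ ≤ Cℓ ∫_{I₀} |f|² ≤ Cℓ A_j`
    set 𝒜 : ℝ := ∫ x, ‖f x‖ ^ (1 / 2 : ℝ) * ρ₀ x with h𝒜
    set ℬ : ℝ := (∫ y, H₁ y * ρ₁ y) + ∫ y, H₂ y * ρ₂ y with hℬ
    have h𝒜0 : 0 ≤ 𝒜 := integral_nonneg fun x => mul_nonneg (Real.rpow_nonneg (norm_nonneg _) _) (hρ₀0 x)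
    have hℬ0 : 0 ≤ ℬ := add_nonneg (integral_nonneg fun y => mul_nonneg (hH₁0 y) (hρ₁0 y))
      (integral_nonneg fun y => mul_nonneg (hH₂0 y) (hρ₂0 y))
    have h16 : 𝒜 ^ 4 ≤ Cℓ * Aj j := by
      have h := h213 (fun x => ‖f x‖ ^ (1 / 2 : ℝ)) (fun x => Real.rpow_nonneg (norm_nonneg _) _)
        (hfcont.norm.measurable.pow_const _) ⟨B₀ ^ (1 / 2 : ℝ), fun x =>
          Real.rpow_le_rpow (norm_nonneg _) (hfbd x) (by norm_num)⟩
      refine h.trans (mul_le_mul_of_nonneg_left ?_ hCℓpos.le)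
      have hpow : ∀ x, (‖f x‖ ^ (1 / 2 : ℝ)) ^ 4 = ‖f x‖ ^ 2 := fun x => by
        rw [← Real.rpow_natCast (‖f x‖ ^ (1 / 2 : ℝ)) 4, ← Real.rpow_mul (norm_nonneg _)]
        norm_num
      simp_rw [hpow]
      refine setIntegral_mono_set hf2i.integrableOn (Eventually.of_forall fun _ => sq_nonneg _)
        (Eventually.of_forall ?_)
      intro x hx
      simp only [ha] at hx
      exact ⟨by linarith [hx.1], by linarith [hx.2]⟩
    -- (3.17): `ℬ ≤ (2/r) B_j`
    have h17 : ℬ ≤ 2 / r * Bj j := by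
      have hw : ∀ x, Real.exp (-(max (a - x) (max (x - (a + c₀ / 2)) 0))) = Real.exp (-(dj j x)) := by
        intro x; simp only [hdj, ha]
      have hWm : AEStronglyMeasurable (fun x => Real.exp (-(dj j x))) volume :=
        (Real.continuous_exp.comp (hdjc j).neg).aestronglyMeasurable
      have hW₁ : Integrable fun x => Real.exp (-(dj j x)) * H₁ x :=
        hH₁i.bdd_mul hWm (Eventually.of_forall fun x => by
          rw [Real.norm_of_nonneg (Real.exp_nonneg _)]; exact hexpd j x)
      have hW₂ : Integrable fun x => Real.exp (-(dj j x)) * H₂ x :=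
        hH₂i.bdd_mul hWm (Eventually.of_forall fun x => by
          rw [Real.norm_of_nonneg (Real.exp_nonneg _)]; exact hexpd j x)
      have h1 : ∫ y, H₁ y * ρ₁ y ≤ 2 / r * ∫ y, Real.exp (-(dj j y)) * H₁ y := by
        rw [← integral_const_mul]
        refine integral_mono_of_nonneg (Eventually.of_forall fun y => mul_nonneg (hH₁0 y) (hρ₁0 y))
          (hW₁.const_mul _) (Eventually.of_forall fun y => ?_)
        have h := h214a y
        rw [hw y] at h
        have := mul_le_mul_of_nonneg_left h (hH₁0 y)
        show H₁ y * ρ₁ y ≤ 2 / r * (Real.exp (-(dj j y)) * H₁ y)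
        linarith
      have h2 : ∫ y, H₂ y * ρ₂ y ≤ 2 / r * ∫ y, Real.exp (-(dj j y)) * H₂ y := by
        rw [← integral_const_mul]
        refine integral_mono_of_nonneg (Eventually.of_forall fun y => mul_nonneg (hH₂0 y) (hρ₂0 y))
          (hW₂.const_mul _) (Eventually.of_forall fun y => ?_)
        have h := h214b y
        rw [hw y] at h
        have := mul_le_mul_of_nonneg_left h (hH₂0 y)
        show H₂ y * ρ₂ y ≤ 2 / r * (Real.exp (-(dj j y)) * H₂ y)
        linarith
      have hBsplit : Bj j = (∫ y, Real.exp (-(dj j y)) * H₁ y) + ∫ y, Real.exp (-(dj j y)) * H₂ y := by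
        simp only [hBj]
        rw [← integral_add hW₁ hW₂]
        refine integral_congr_ae (Eventually.of_forall fun y => ?_)
        show Real.exp (-(dj j y)) * (H₁ y + H₂ y) = Real.exp (-(dj j y)) * H₁ y + Real.exp (-(dj j y)) * H₂ y
        ring
      rw [hBsplit, mul_add]
      exact add_le_add h1 h2
    have hX := pointwise_bound_algebra h𝒜0 hℬ0 (hAj0 j) (hBj0 j) hCℓpos.le hr0 hr1.le hκ0.le hκ1.le
      hint h16 h17
    simpa only [hMℓ] using hX
  ----------------------------------------------------------------
  -- Step 2: integrating the per-point bound in `t`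
  ----------------------------------------------------------------
  set P₀ : ℝ := ∫ x in U, ‖f x‖ ^ 2 with hP₀
  have hP₀0 : 0 ≤ P₀ := setIntegral_nonneg hUm fun _ _ => sq_nonneg _
  have hP₀E : P₀ ≤ E :=
    (setIntegral_le_integral hf2i (Eventually.of_forall fun _ => sq_nonneg _)).trans hfE
  set A : ℝ → ℝ := fun t => Aj ⌊t⌋ with hA
  set Q : ℝ → ℝ := fun t => Aj ⌊t⌋ + Bj ⌊t⌋ with hQ
  have hAjm : Measurable Aj := measurable_of_countable Aj
  have hBjm : Measurable Bj := measurable_of_countable Bj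
  have hAmeas : Measurable A := hAjm.comp Int.measurable_floor
  have hQmeas : Measurable Q := (hAjm.comp Int.measurable_floor).add (hBjm.comp Int.measurable_floor)
  have hA0 : ∀ t, 0 ≤ A t := fun t => hAj0 _
  have hAQ : ∀ t, A t ≤ Q t := fun t => by simp only [hA, hQ]; linarith [hBj0 ⌊t⌋]
  -- (a) `∫ A ≤ 2 P₀` via Tonelli with the slit kernel
  have hf2m : Measurable fun x => ENNReal.ofReal (‖f x‖ ^ 2) :=
    (hfcont.norm.pow 2).measurable.ennreal_ofReal
  set S : Set (ℝ × ℝ) := {p | p.2 ∈ Icc (s ⌊p.1⌋ - c₀ / 2) (s ⌊p.1⌋ + c₀ / 2)} with hSdef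
  have hSm : MeasurableSet S := by
    have hfl : Measurable fun p : ℝ × ℝ => s ⌊p.1⌋ :=
      (measurable_of_countable s).comp (Int.measurable_floor.comp measurable_fst)
    simp only [hSdef, Set.mem_Icc]
    exact (measurableSet_le (hfl.sub_const _) measurable_snd).inter
      (measurableSet_le measurable_snd (hfl.add_const _))
  have hAlint : ∫⁻ t, ENNReal.ofReal (A t) ≤ 2 * ENNReal.ofReal P₀ := by
    have h1 : ∀ t, ENNReal.ofReal (A t) = ∫⁻ x, S.indicator 1 (t, x) *
        U.indicator (fun x => ENNReal.ofReal (‖f x‖ ^ 2)) x := by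
      intro t
      simp only [hA, hAj]
      rw [ofReal_integral_eq_lintegral_ofReal hf2i.integrableOn (Eventually.of_forall fun _ => sq_nonneg _),
        ← lintegral_indicator measurableSet_Icc]
      refine lintegral_congr fun x => ?_
      by_cases hx : x ∈ Icc (s ⌊t⌋ - c₀ / 2) (s ⌊t⌋ + c₀ / 2)
      · have hxS : (t, x) ∈ S := hx
        have hxU : x ∈ U := Set.mem_iUnion.2 ⟨⌊t⌋, hx⟩
        rw [Set.indicator_of_mem hx, Set.indicator_of_mem hxS, Set.indicator_of_mem hxU, Pi.one_apply, one_mul]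
      · have hxS : (t, x) ∉ S := hx
        rw [Set.indicator_of_notMem hx, Set.indicator_of_notMem hxS, zero_mul]
    simp_rw [h1]
    have hker := lintegral_lintegral_kernel_le (k := fun t x => S.indicator 1 (t, x))
      ((measurable_one.indicator hSm)) (K := 2) (fun x => by
        have hsec : MeasurableSet {t : ℝ | (t, x) ∈ S} := hSm.preimage (measurable_id.prodMk measurable_const)
        have : (fun t => S.indicator (1 : ℝ × ℝ → ℝ≥0∞) (t, x)) = {t : ℝ | (t, x) ∈ S}.indicator 1 := by
          funext t; by_cases h : (t, x) ∈ S <;> simp [h, Set.indicator]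
        rw [this, lintegral_indicator_one hsec]
        exact volume_setOf_mem_cell_floor_le hs x)
      (hf2m.indicator hUm)
    refine hker.trans (le_of_eq ?_)
    rw [lintegral_indicator hUm, ← ofReal_integral_eq_lintegral_ofReal hf2i.integrableOn
      (Eventually.of_forall fun _ => sq_nonneg _)]
  have hAint : Integrable A := by
    refine ⟨hAmeas.aestronglyMeasurable, ?_⟩
    rw [hasFiniteIntegral_iff_enorm]
    have : ∫⁻ t, ‖A t‖ₑ = ∫⁻ t, ENNReal.ofReal (A t) := lintegral_congr fun t => Real.enorm_eq_ofReal (hA0 t)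
    rw [this]
    exact hAlint.trans_lt (by simp [ENNReal.mul_lt_top])
  have hAval : ∫ t, A t ≤ 2 * P₀ := by
    rw [integral_eq_lintegral_of_nonneg_ae (Eventually.of_forall hA0) hAmeas.aestronglyMeasurable]
    have := ENNReal.toReal_mono (by simp [ENNReal.mul_ne_top] : 2 * ENNReal.ofReal P₀ ≠ ⊤) hAlint
    rwa [ENNReal.toReal_mul, ENNReal.toReal_ofReal hP₀0, ENNReal.toReal_ofNat] at this
  -- (b) `∫ B ≤ 2e ∫(H₁+H₂) ≤ 4e E` via Tonelli with the line kernel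
  have hHm : Measurable fun x => ENNReal.ofReal (H₁ x + H₂ x) := (hH₁c.add hH₂c).measurable.ennreal_ofReal
  have hT2 : ∀ t x, Real.exp (-(dj ⌊t⌋ x)) ≤ Real.exp (1 - |x - t|) := by
    intro t x
    set j : ℤ := ⌊t⌋
    have hsj1 : (j : ℝ) ≤ s j - c₀ / 2 := ((hs j) (left_mem_Icc.2 (by linarith))).1
    have hsj2 : s j + c₀ / 2 ≤ j + 1 := ((hs j) (right_mem_Icc.2 (by linarith))).2
    have ht1 : (j : ℝ) ≤ t := Int.floor_le t
    have ht2 : t < j + 1 := Int.lt_floor_add_one t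
    rw [Real.exp_le_exp]
    have hd1 : s j - c₀ / 4 - x ≤ dj j x := le_max_left _ _
    have hd2 : x - (s j - c₀ / 4 + c₀ / 2) ≤ dj j x := le_max_of_le_right (le_max_left _ _)
    have hd3 : 0 ≤ dj j x := hdj0 j x
    have habs : |x - t| - 1 ≤ dj j x := by
      rw [sub_le_iff_le_add]
      rcases le_or_gt x t with hxt | hxt
      · rw [abs_of_nonpos (by linarith)]; linarith
      · rw [abs_of_pos (by linarith)]; linarith
    linarith
  have hBlint : ∫⁻ t : ℝ, ENNReal.ofReal (Bj ⌊t⌋) ≤ ENNReal.ofReal (2 * Real.exp 1) * ENNReal.ofReal (∫ x, (H₁ x + H₂ x)) := by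
    have h1 : ∀ t : ℝ, ENNReal.ofReal (Bj ⌊t⌋) ≤ ∫⁻ x : ℝ, ENNReal.ofReal (Real.exp (1 - |x - t|)) *
        ENNReal.ofReal (H₁ x + H₂ x) := by
      intro t
      simp only [hBj]
      rw [ofReal_integral_eq_lintegral_ofReal (hBint ⌊t⌋) (Eventually.of_forall fun x =>
        mul_nonneg (Real.exp_nonneg _) (add_nonneg (hH₁0 x) (hH₂0 x)))]
      refine lintegral_mono fun x => ?_
      rw [← ENNReal.ofReal_mul (Real.exp_nonneg _)]
      exact ENNReal.ofReal_le_ofReal (mul_le_mul_of_nonneg_right (hT2 t x) (add_nonneg (hH₁0 x) (hH₂0 x)))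
    refine (lintegral_mono h1).trans ?_
    have hker := lintegral_lintegral_kernel_le (k := fun t x => ENNReal.ofReal (Real.exp (1 - |x - t|)))
      ((Real.continuous_exp.comp (by fun_prop)).measurable.ennreal_ofReal) (K := ENNReal.ofReal (2 * Real.exp 1))
      (fun x => lintegral_exp_one_sub_abs_le x) hHm
    refine hker.trans (le_of_eq ?_)
    have hHi : Integrable (fun x => H₁ x + H₂ x) := hH₁i.add hH₂i
    congr 1
    exact (ofReal_integral_eq_lintegral_ofReal hHi
      (Eventually.of_forall fun x => add_nonneg (hH₁0 x) (hH₂0 x))).symm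
  have hHsum : ∫ x, (H₁ x + H₂ x) ≤ 2 * E := by
    rw [integral_add hH₁i hH₂i]; linarith
  have hB0 : ∀ t : ℝ, 0 ≤ Bj ⌊t⌋ := fun t => hBj0 _
  have hBmeas : Measurable fun t : ℝ => Bj ⌊t⌋ := hBjm.comp Int.measurable_floor
  have hBlint' : ∫⁻ t : ℝ, ENNReal.ofReal (Bj ⌊t⌋) ≤ ENNReal.ofReal (2 * Real.exp 1 * (2 * E)) := by
    refine hBlint.trans ?_
    rw [← ENNReal.ofReal_mul (by positivity)]
    exact ENNReal.ofReal_le_ofReal (mul_le_mul_of_nonneg_left hHsum (by positivity))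
  have hBint2 : Integrable fun t : ℝ => Bj ⌊t⌋ := by
    refine ⟨hBmeas.aestronglyMeasurable, ?_⟩
    rw [hasFiniteIntegral_iff_enorm]
    have : ∫⁻ t : ℝ, ‖Bj ⌊t⌋‖ₑ = ∫⁻ t : ℝ, ENNReal.ofReal (Bj ⌊t⌋) := lintegral_congr fun t => Real.enorm_eq_ofReal (hB0 t)
    rw [this]
    exact hBlint'.trans_lt ENNReal.ofReal_lt_top
  have hBval : ∫ t : ℝ, Bj ⌊t⌋ ≤ 2 * Real.exp 1 * (2 * E) := by
    rw [integral_eq_lintegral_of_nonneg_ae (Eventually.of_forall hB0) hBmeas.aestronglyMeasurable]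
    exact ENNReal.toReal_le_of_le_ofReal (by positivity) hBlint'
  have hQint : Integrable Q := by
    have : Q = fun t : ℝ => A t + Bj ⌊t⌋ := rfl
    rw [this]; exact hAint.add hBint2
  have hQval : ∫ t, Q t ≤ (2 + 4 * Real.exp 1) * E := by
    have : ∫ t, Q t = (∫ t, A t) + ∫ t : ℝ, Bj ⌊t⌋ := integral_add hAint hBint2
    rw [this]; nlinarith [hAval, hBval, hP₀E, Real.exp_pos 1]
  -- (c) Hölder by AM–GM
  obtain ⟨hAQi, hHolder⟩ := integral_rpow_mul_rpow_le hA0 hAQ hAmeas hQmeas hAint hQint hκ0 hκ1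
  ----------------------------------------------------------------
  -- Step 3: assembly
  ----------------------------------------------------------------
  have hcompl : ∫ x in Uᶜ, ‖f x‖ ^ 2 ≤ 10 * (Mℓ / r) * ((2 * P₀) ^ κ * ((2 + 4 * Real.exp 1) * E) ^ (1 - κ)) := by
    have h1 : ∫ x in Uᶜ, ‖f x‖ ^ 2 ≤ ∫ x in Uᶜ, 10 * (Mℓ / r) * (A x ^ κ * Q x ^ (1 - κ)) :=
      setIntegral_mono_on hf2i.integrableOn (hAQi.const_mul _).integrableOn hUm.compl
        (fun t ht => hpt t ht)
    have h2 : ∫ x in Uᶜ, 10 * (Mℓ / r) * (A x ^ κ * Q x ^ (1 - κ)) ≤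
        ∫ x, 10 * (Mℓ / r) * (A x ^ κ * Q x ^ (1 - κ)) :=
      setIntegral_le_integral (hAQi.const_mul _) (Eventually.of_forall fun t =>
        mul_nonneg (by positivity) (mul_nonneg (Real.rpow_nonneg (hA0 t) _)
          (Real.rpow_nonneg ((hA0 t).trans (hAQ t)) _)))
    have h3 : ∫ x, 10 * (Mℓ / r) * (A x ^ κ * Q x ^ (1 - κ)) =
        10 * (Mℓ / r) * ∫ x, A x ^ κ * Q x ^ (1 - κ) := integral_const_mul _ _
    refine h1.trans (h2.trans (h3.le.trans
      (mul_le_mul_of_nonneg_left (hHolder.trans ?_) (by positivity))))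
    exact mul_le_mul (Real.rpow_le_rpow (integral_nonneg hA0) hAval hκ0.le)
      (Real.rpow_le_rpow (integral_nonneg fun t => (hA0 t).trans (hAQ t)) hQval (by linarith))
      (Real.rpow_nonneg (integral_nonneg fun t => (hA0 t).trans (hAQ t)) _) (by positivity)
  have htot : ∫ x, ‖f x‖ ^ 2 = P₀ + ∫ x in Uᶜ, ‖f x‖ ^ 2 := (integral_add_compl hUm hf2i).symm
  -- numerical simplifications
  have h2κ : (2 * P₀) ^ κ ≤ 2 * P₀ ^ κ := by
    rw [Real.mul_rpow (by norm_num) hP₀0]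
    refine mul_le_mul_of_nonneg_right ?_ (Real.rpow_nonneg hP₀0 _)
    calc (2:ℝ) ^ κ ≤ (2:ℝ) ^ (1:ℝ) := Real.rpow_le_rpow_of_exponent_le (by norm_num) hκ1.le
      _ = 2 := Real.rpow_one 2
  have hc1 : (1 : ℝ) ≤ 2 + 4 * Real.exp 1 := by have := Real.exp_pos 1; linarith
  have hEκ : ((2 + 4 * Real.exp 1) * E) ^ (1 - κ) ≤ (2 + 4 * Real.exp 1) * E ^ (1 - κ) := by
    rw [Real.mul_rpow (by linarith) hE0]
    refine mul_le_mul_of_nonneg_right ?_ (Real.rpow_nonneg hE0 _)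
    calc (2 + 4 * Real.exp 1) ^ (1 - κ) ≤ (2 + 4 * Real.exp 1) ^ (1:ℝ) :=
          Real.rpow_le_rpow_of_exponent_le hc1 (by linarith)
      _ = _ := Real.rpow_one _
  have hPκ : P₀ ≤ P₀ ^ κ * E ^ (1 - κ) := by
    calc P₀ = P₀ ^ κ * P₀ ^ (1 - κ) := by rw [← Real.rpow_add' hP₀0 (by linarith)]; norm_num
      _ ≤ P₀ ^ κ * E ^ (1 - κ) :=
          mul_le_mul_of_nonneg_left (Real.rpow_le_rpow hP₀0 hP₀E (by linarith)) (Real.rpow_nonneg hP₀0 _)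
  have hPE0 : 0 ≤ P₀ ^ κ * E ^ (1 - κ) := mul_nonneg (Real.rpow_nonneg hP₀0 _) (Real.rpow_nonneg hE0 _)
  have hr1' : (1:ℝ) ≤ 1 / r := by rw [le_div_iff₀ hr0]; linarith
  calc ∫ x, ‖f x‖ ^ 2 = P₀ + ∫ x in Uᶜ, ‖f x‖ ^ 2 := htot
    _ ≤ P₀ ^ κ * E ^ (1 - κ) + 10 * (Mℓ / r) * ((2 * P₀ ^ κ) * ((2 + 4 * Real.exp 1) * E ^ (1 - κ))) := by
        refine add_le_add hPκ (hcompl.trans (mul_le_mul_of_nonneg_left (mul_le_mul h2κ hEκ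
          (Real.rpow_nonneg (by positivity) _) (by positivity)) (by positivity)))
    _ = (1 + 20 * Mℓ * (2 + 4 * Real.exp 1) / r) * (P₀ ^ κ * E ^ (1 - κ)) := by ring
    _ ≤ (Cbig / r) * (P₀ ^ κ * E ^ (1 - κ)) := by
        refine mul_le_mul_of_nonneg_right ?_ hPE0
        rw [hCbig, add_div]
        have : (1:ℝ) ≤ 1 / r := hr1'
        nlinarith [show 0 ≤ 20 * Mℓ * (2 + 4 * Real.exp 1) / r by positivity]
    _ ≤ C / r * (P₀ ^ κ * E ^ (1 - κ)) :=
        mul_le_mul_of_nonneg_right (div_le_div_of_nonneg_right hCb hr0.le) hPE0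
    _ = C / r * P₀ ^ κ * E ^ (1 - κ) := by ring

end Literature.Analysis.Fourier
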